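import Literature.MathematicalPhysics.QuantumFieldTheory.Balaban1983to89.Node00.Record12CarriersB13
import Literature.MathematicalPhysics.QuantumFieldTheory.Balaban1983to89.B13NodeTorusFamily

/-!
# NODE 00 (YM-PLAN Track A) — THE [B13] LAYER IN THE HISTORY-INDEXED FAMILY CURRENCY AT THE GROUP OF RECORD, AND THE STAGE-12 LETTERS OF RECORD
# of [II]'s constants: `ResidB13Fam`, `S13FamOfRecord`, `B13FamLeafOfRecord` (Stage 3′); `c13OfRecord₁₂` (L, δ, γ, E₀, κ of record; **R22 PROVED**),
# `B13FamLeafOfRecord₁₂` (Stage 12); the member bridge to the instance leaf `B13LeafOfRecord`; honesty in the family currency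

NODE 00 DEFINER MODULE (seat `pub-ymgap-node00-def-B13` g3, 2026-08-26; director-ym R141 (A) row «`Node00/CarriersB13.lean`, term tower; N10 s1 pin half»; the
object named by LOCATED-N10-ZEROTOWER (dag-n10-d l.13856 ∕ dag-lead DEDUP-207): «content would enter only through a TERM TOWER OF RECORD»).  The TERM-TOWER CENSUS of
this seat (desk memo `TERM-TOWER-CENSUS.md`) finds that the tower's 38 term fields OF RECORD ([I] §§2–3 (1.25)–(1.33), [13]'s walk expansions, [15]'s minimizers, the
decoupling (1.10), the Cauchy extraction (1.23)) are an XL construction over untyped machinery (def-T SECT2FORM: «[III] §3's recursion typed, later programme»), and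
that TWO storeys of it ARE typable now and are what the consumers read BY NAME:

(1) **THE FAMILY CURRENCY.**  N09's consumer of [II] at a record — `B12NodeKnit.b12_main_of_up_frameOf_of_b13Family_eHolo` ((iv⁵); TS-3 word (R1)) — reads [B13] as a
    HISTORY-INDEXED FAMILY `S13 : (k : ℕ) → (Fin (k + 1) → ℝ) → B13.StepData` (one step datum per step `k` and coupling history `v = (g_0, …, g_k)`), with ONE
    constants record `c13`, on the box `FlowStep.Box γ13 k = ]0, γ13]^{k+1}` (`hfam : b13 → ∀ k v, v ∈ Box γ13 k → Lemma1Printed (S13 k v) c13 ∧ Lemma2Printed … ∧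
    Lemma3Printed …`, `h22 : c13.R22`, `hγ13 : c.γ ≤ γ13`, …), exactly as [I]'s Theorem 3 consumes Lemmas 1–3 at EVERY step of a run with the LAST coupling variable
    (the β-function argument).  The DAG slot `PrintedCarriersR.S13` — g0 ∕ g2's `lam13 : B12.RunParams → ResidB13 θ₃` (`CarriersB13`, `Record12CarriersB13.pinB13`) — is
    ONE step datum per run: faithful at an INSTANCE `(k, v)`, not the family.  House precedent: `Node00/CarriersB12Family` («the DAG leaf reads ONE instance per run;
    print's Lemma is the family»; constants shared, no pin).  §1 types the family at the group of record: `ResidB13Fam θ` (a residual [B13] term layer per `(k, v)`),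
    `S13FamOfRecord θ lamF k v := (WtOfRecord θ (lamF k v)).toStepData` (EXACTLY (iv⁵)'s `S13` type), `B13FamLeafOfRecord θ γ₀ lamF c` (the family statement, ONE `c`),
    its box monotonicity ∕ per-run reading (`B13NodeTorusFamily.b13Family_mono ∕ _at_prefix` by name) and the MEMBER BRIDGE `b13LeafOfRecord_iff_of_c13OfRecord_eq`
    to g0's instance leaf `B13LeafOfRecord θ (lamF k v)` (so N10's located ∕ termwise junctions `N10AtRecord11B13.b13LeafOfRecord_of_located(_termwise)` apply MEMBER-WISE,
    and g2's `pinB13` at the instance `lamF P k v` is the DAG pin).  The members' own `k`, `g`, `c` FIELDS are NOT read as the family's indices ∕ constants (`WtOfRecord`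
    reads `lam.k` as the (1.33) scale range and `lam.g` in (1.40)–(1.42)); a term tower of record sets them to `k`, `g_k = v (Fin.last k)` ([I] (2.12) `B = g_k B′`) — the
    DISPLAYED index law `ResidB13Fam.IsStepIndexed`, not consumer-facing.
(2) **THE STAGE-12 LETTERS OF RECORD** `c13OfRecord₁₂ θ c := { c with L := θ.ℓ₆ + 1, δ := (1 − 2∕(ℓ₆+1))∕10, γ := θ.γ, E₀ := θ.s2.lf.E₀, κ := θ.s2.lf.κ }`:
    `L` = the block size (`Stage3Params.hℓ₆`); `δ` := p. 21 «At first we assume that (1 − 10δ)½L = 1, or δ = (1∕10)(1 − 2L⁻¹)» — restriction R22 AS A DEFINITION, so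
    **`c13OfRecord₁₂_R22 : (c13OfRecord₁₂ F N θ c).R22` is PROVED** (discharging (iv⁵)'s `h22` at the record) and `0 < δ < 1∕10` (`B13.Consts.delta_bounds_of_R22`,
    `L ≥ 3` odd); `γ` := the coupling window of record `Stage5Params.γ` (R16's «g_k ≤ γ», [I] Thm 3); `E₀`, `κ` := (I.1.18)'s — [II] p. 21 «The inequality (2.41) and the
    assumptions imply the inequality (I.1.18), with ½E₀ instead of E₀ … We define ½E₀ as equal to this constant», [III] p. 17 «(iv) it satisfies the inequality (I.1.18).
    These properties are the same as in [I.1]» = def-T's `Step.LFConsts.E₀ ∕ κ` at `θ.s2.lf` (print-checked: `paper:balaban1988-cmp116-rg-ii-cluster` p. 21,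
    `paper:balaban1988-cmp119-convergent-renormalization` p. 17).  RESIDUAL, with the census saying why: `q`, `M` (which M — [I]'s cube size, `τ9.M` of [IV] (2.1),
    `s2.Mr` of [III] (2.38) — unresolved), `κ₁`, `δ₀` (`Stage3Params.δ₀` is [Balaban1984PropagatorsII] Lemma 2.1's rate; p. 21's «δ₀M ≥ κ» is the rate of [16]'s walk
    expansion — plausibly one letter, not certain), `ε₁`, `C₁`, `C₂`, `C₃`, the radii `α`, `γ₂`, `A₁` (NOT `θ.A₁` of (3.4)), `A₂`.  §2 also types the Stage-12 family of
    record per run `B13FamLeafOfRecord₁₂ θ lamF c P := B13FamLeafOfRecord θ₃ θ.γ (lamF P) (c13OfRecord₁₂ θ c)` (box = the window OF RECORD; ONE `c` for ALL runs — print's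
    constants are uniform in ε = L^{−K}, the point of the series), (iv⁵)'s `hfam` binder BY SHAPE, the reading at the record's generated couplings `gOfRecord₁₀`.
(3) **HONESTY in the family currency** (§3): the CONSTANT ZERO family (g2's `exists_residB13_b13LeafOfRecord_univ_of_nonneg`) satisfies `B13FamLeafOfRecord` on every box
    for any letters with non-negative prefactors, at Stage 12 for every residual `c` with `ε₁ = 0`; a `GaugeInv := False` family fails.  Reading (LOCATED-N10-ZEROTOWER,
    member-wise): in the ∃-currency over `lamF` the family leaf is junk through lever (i) = THE TERMS; content = the identification of each member's terms with the record's
    step-`k` expansion at history `v` (the term tower of record proper, XL, absent) — or the ∀-lawful ∕ termwise currency (`B13NodeTorusFamily.b13Family_of_termwise`,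
    n10-d's junctions), which quantifies over the layer.

NOT in this module: the term fields of record (XL, above); a Stage-12 pin of a FAMILY into `Stage12Params` (the DAG slot is single-step — g2's `pinB13` at an instance
is the pin); `Restr` ∕ R15–R24 beyond R22 (they constrain residual letters); the consumer junctions (dag-n10-d's lane).

HONEST FRAMING: definitions + kernel bookkeeping (`rfl` ∕ `Iff.rfl` ∕ transport) + ONE real-arithmetic identity (R22 at `L = ℓ₆ + 1`); NO estimate of Bałaban's asserted
or constructed; N10 NOT discharged (nor N09); counts unmoved; K0′ (`Record12` inhabitation) not touched; one finite 𝕋⁴ programme at fixed ε, Bałaban as printed — NOT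
continuum ∕ ℝ⁴ ∕ infinite volume ∕ OS ∕ mass gap ∕ Clay.  No `sorry`, no `axiom`, no `opaque`, no `instance` declaration, no `notation`. -/

noncomputable section

namespace Literature.MathematicalPhysics.QuantumFieldTheory.Balaban1983to89.Node00

open T4Continuum AveragingRT T4FiniteEpsInhabited FlowStep FlowStepRuns DagBinding T4DatumAssembly
open scoped Matrix.Norms.L2Operator
open Literature.MathematicalPhysics.QuantumFieldTheory.Balaban1983to89.TreeLengthTorus (TDom TPt tsys IsTDom)

/-! ## §1. Stage 3′: the [B13] layer as a HISTORY-INDEXED FAMILY at the group of record -/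

section Family

variable (θ : Stage3Params)

/-- **A history-indexed residual [B13] term layer**: one residual layer `lamF k v : ResidB13 θ` per step `k` and coupling history `v = (g_0, …, g_k) ∈ ℝ^{k+1}` —
the index set of [I]'s Theorem 3 ∕ N09's (iv⁵) consumer (`S13 : (k : ℕ) → (Fin (k + 1) → ℝ) → B13.StepData`).  The members' own `k`, `g`, `c` fields are NOT read as
the family's indices ∕ constants (displayed law `IsStepIndexed`). [cite: Balaban1987RG1, Thm 3 p.264 (Lemmas 1–3 consumed at every step, last coupling variable); Balaban1988RG2Cluster, Lemmas 1–3 pp.9, 11, 20] -/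
abbrev ResidB13Fam (θ : Stage3Params) := (k : ℕ) → (Fin (k + 1) → ℝ) → ResidB13 θ

/-- **The [B13] step data OF RECORD as a history-indexed family**: member `(k, v)` ↦ the step data of the group of record `WtOfRecord θ (lamF k v)` — EXACTLY the type
`(k : ℕ) → (Fin (k + 1) → ℝ) → B13.StepData` N09's (iv⁵) consumer reads. [cite: Balaban1988RG2Cluster, (1.33)–(1.42) pp.9–11, (2.9) p.14 (objects of record)] -/
def S13FamOfRecord (lamF : ResidB13Fam θ) : (k : ℕ) → (Fin (k + 1) → ℝ) → B13.StepData := fun k v => (WtOfRecord θ (lamF k v)).toStepData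

/-- `S13FamOfRecord` at a member is the member's step data of record. [cite: Balaban1988RG2Cluster, (1.33) p.9 (bookkeeping)] -/
@[simp] theorem S13FamOfRecord_apply (lamF : ResidB13Fam θ) (k : ℕ) (v : Fin (k + 1) → ℝ) :
    S13FamOfRecord θ lamF k v = (WtOfRecord θ (lamF k v)).toStepData := rfl

/-- **THE [B13] LEAF IN THE FAMILY CURRENCY AT THE GROUP OF RECORD**: for every step `k` and every coupling history `v` in the box `]0, γ₀]^{k+1}`, Lemma 1 ∧
Lemma 2 ∧ Lemma 3 AS PRINTED hold for the member's step data of record with the family's ONE constants record `c` (the `c` the Lemmas READ — at Stage 12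
`c13OfRecord₁₂ θ c₀`, the letters of record).  This is (iv⁵)'s `hfam` conclusion verbatim at `S13 := S13FamOfRecord θ lamF`, `c13 := c`, `γ13 := γ₀`.
[cite: Balaban1988RG2Cluster, Lemma 1 p.9, Lemma 2 p.11, Lemma 3 p.20; Balaban1987RG1, Thm 3 p.264 (the family over the run)] -/
def B13FamLeafOfRecord (γ₀ : ℝ) (lamF : ResidB13Fam θ) (c : B13.Consts) : Prop :=
  ∀ k v, v ∈ FlowStep.Box γ₀ k →
    B13.Lemma1Printed (S13FamOfRecord θ lamF k v) c ∧ B13.Lemma2Printed (S13FamOfRecord θ lamF k v) c ∧ B13.Lemma3Printed (S13FamOfRecord θ lamF k v) c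

variable {θ}

/-- The family leaf unfolded (the (iv⁵) `hfam` shape). [cite: Balaban1988RG2Cluster, Lemmas 1–3 pp.9, 11, 20 (bookkeeping)] -/
theorem b13FamLeafOfRecord_iff {γ₀ : ℝ} {lamF : ResidB13Fam θ} {c : B13.Consts} :
    B13FamLeafOfRecord θ γ₀ lamF c ↔ ∀ k v, v ∈ FlowStep.Box γ₀ k →
      B13.Lemma1Printed (WtOfRecord θ (lamF k v)).toStepData c ∧ B13.Lemma2Printed (WtOfRecord θ (lamF k v)).toStepData c ∧
        B13.Lemma3Printed (WtOfRecord θ (lamF k v)).toStepData c := Iff.rfl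

/-- The family leaf at a member in the box. [cite: Balaban1988RG2Cluster, Lemmas 1–3 pp.9, 11, 20 (bookkeeping)] -/
theorem b13FamLeafOfRecord_apply {γ₀ : ℝ} {lamF : ResidB13Fam θ} {c : B13.Consts} (h : B13FamLeafOfRecord θ γ₀ lamF c) {k : ℕ} {v : Fin (k + 1) → ℝ}
    (hv : v ∈ FlowStep.Box γ₀ k) :
    B13.Lemma1Printed (WtOfRecord θ (lamF k v)).toStepData c ∧ B13.Lemma2Printed (WtOfRecord θ (lamF k v)).toStepData c ∧
      B13.Lemma3Printed (WtOfRecord θ (lamF k v)).toStepData c := h k v hv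

/-- **Box monotonicity** (N09's guard «`w.γ ≤ γ13`»): the family leaf on the box `γ₀` restricts to every smaller box — `B13NodeTorusFamily.b13Family_mono` by name.
[cite: Balaban1987RG1, Thm 1 p.259 (the interval constant; bookkeeping)] -/
theorem b13FamLeafOfRecord_mono {γ γ₀ : ℝ} (hγ : γ ≤ γ₀) {lamF : ResidB13Fam θ} {c : B13.Consts} (h : B13FamLeafOfRecord θ γ₀ lamF c) :
    B13FamLeafOfRecord θ γ lamF c :=
  B13NodeTorusFamily.b13Family_mono hγ (S13FamOfRecord θ lamF) c h

/-- **The per-run reading**: along couplings `0 < g_i ≤ γ ≤ γ₀` (`i ≤ k`) the family leaf yields Lemmas 1–3 at the member of the prefix history `(g_0, …, g_k)` —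
`B13NodeTorusFamily.b13Family_at_prefix` by name. [cite: Balaban1987RG1, Thm 3 p.264 (consumes Lemmas 1–3 at every step)] -/
theorem b13FamLeafOfRecord_at_prefix {γ γ₀ : ℝ} (hγ : γ ≤ γ₀) {lamF : ResidB13Fam θ} {c : B13.Consts} (h : B13FamLeafOfRecord θ γ₀ lamF c) {g : ℕ → ℝ}
    {k : ℕ} (hg : ∀ i, i ≤ k → 0 < g i ∧ g i ≤ γ) :
    B13.Lemma1Printed (WtOfRecord θ (lamF k (prefixOf g k))).toStepData c ∧ B13.Lemma2Printed (WtOfRecord θ (lamF k (prefixOf g k))).toStepData c ∧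
      B13.Lemma3Printed (WtOfRecord θ (lamF k (prefixOf g k))).toStepData c :=
  B13NodeTorusFamily.b13Family_at_prefix hγ (S13FamOfRecord θ lamF) c h hg

/-- **MEMBER BRIDGE to the instance leaf**: when the member's letters of record ARE the family's constants (`c13OfRecord θ (lamF k v) = c`, i.e. `(lamF k v).c` with
`L := θ.ℓ₆ + 1` is `c`), the family's triple at `(k, v)` IS g0's instance leaf `B13LeafOfRecord θ (lamF k v)` — so N10's located ∕ termwise junctions at the group of
record apply member-wise, and `pinB13` at the instance is the DAG pin. [cite: Balaban1988RG2Cluster, Lemmas 1–3 pp.9, 11, 20 (bookkeeping)] -/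
theorem b13LeafOfRecord_iff_of_c13OfRecord_eq {lamF : ResidB13Fam θ} {c : B13.Consts} {k : ℕ} {v : Fin (k + 1) → ℝ} (hc : c13OfRecord θ (lamF k v) = c) :
    (B13.Lemma1Printed (WtOfRecord θ (lamF k v)).toStepData c ∧ B13.Lemma2Printed (WtOfRecord θ (lamF k v)).toStepData c ∧
        B13.Lemma3Printed (WtOfRecord θ (lamF k v)).toStepData c) ↔ B13LeafOfRecord θ (lamF k v) := by
  rw [← hc]; exact Iff.rfl

/-- From the instance leaves of the members in the box (letters = the family's constants) to the family leaf. [cite: Balaban1988RG2Cluster, Lemmas 1–3 pp.9, 11, 20 (bookkeeping)] -/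
theorem b13FamLeafOfRecord_of_forall_b13LeafOfRecord {γ₀ : ℝ} {lamF : ResidB13Fam θ} {c : B13.Consts}
    (hc : ∀ k v, v ∈ FlowStep.Box γ₀ k → c13OfRecord θ (lamF k v) = c) (h : ∀ k v, v ∈ FlowStep.Box γ₀ k → B13LeafOfRecord θ (lamF k v)) :
    B13FamLeafOfRecord θ γ₀ lamF c :=
  fun k v hv => (b13LeafOfRecord_iff_of_c13OfRecord_eq (hc k v hv)).2 (h k v hv)

/-- From the family leaf to the instance leaf of a member in the box (letters = the family's constants). [cite: Balaban1988RG2Cluster, Lemmas 1–3 pp.9, 11, 20 (bookkeeping)] -/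
theorem b13LeafOfRecord_of_b13FamLeafOfRecord {γ₀ : ℝ} {lamF : ResidB13Fam θ} {c : B13.Consts} (h : B13FamLeafOfRecord θ γ₀ lamF c) {k : ℕ}
    {v : Fin (k + 1) → ℝ} (hv : v ∈ FlowStep.Box γ₀ k) (hc : c13OfRecord θ (lamF k v) = c) : B13LeafOfRecord θ (lamF k v) :=
  (b13LeafOfRecord_iff_of_c13OfRecord_eq hc).1 (h k v hv)

/-- **The DISPLAYED index law of a term tower of record** (not read by the family leaf, not consumer-facing): member `(k, v)` carries the step index `k` (the (1.33)
scale range `j ≤ k`) and the running coupling `g_k = v_k` of the scaling `B = g_k B′` ([I] (2.12)); on the box this gives N10's located input `g ≠ 0`.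
[cite: Balaban1987RG1, (2.12) p.268 (B = g_k B′); Balaban1988RG2Cluster, (1.33) p.9 (the scale range)] -/
def ResidB13Fam.IsStepIndexed (γ₀ : ℝ) (lamF : ResidB13Fam θ) : Prop :=
  ∀ k v, v ∈ FlowStep.Box γ₀ k → (lamF k v).k = k ∧ (lamF k v).g = ((v (Fin.last k) : ℝ) : ℂ)

/-- On the box an indexed member's coupling letter is non-zero (N10's located input `hg`). [cite: Balaban1987RG1, Thm 1 p.259 («0 < g_k ≦ γ»; bookkeeping)] -/
theorem ResidB13Fam.IsStepIndexed.g_ne_zero {γ₀ : ℝ} {lamF : ResidB13Fam θ} (h : ResidB13Fam.IsStepIndexed γ₀ lamF) {k : ℕ} {v : Fin (k + 1) → ℝ}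
    (hv : v ∈ FlowStep.Box γ₀ k) : (lamF k v).g ≠ 0 := by
  rw [(h k v hv).2]
  exact_mod_cast (B13NodeTorusFamily.last_pos_of_mem_box hv).ne'

variable (θ) in
/-- The family type is inhabited (constant families at g0's inhabitant `nonempty_residB13`). [cite: Balaban1988RG2Cluster, Lemmas 1–3 pp.9, 11, 20 (bookkeeping: the layer type is inhabited)] -/
theorem nonempty_residB13Fam : Nonempty (ResidB13Fam θ) := by
  obtain ⟨lam⟩ := nonempty_residB13 θ
  exact ⟨fun _ _ => lam⟩

end Family

/-! ## §2. Stage 12: the LETTERS OF RECORD of [II]'s constants and the family of record per run -/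

section Letters12

variable (F : T4Family) (N : ℕ) [NeZero N]

/-- **THE STAGE-12 LETTERS OF RECORD of [II]'s constants**: `L := θ.ℓ₆ + 1` (the block size), `δ := (1 − 2∕L)∕10` (p. 21 «or δ = (1∕10)(1 − 2L⁻¹)», R22 as a
definition), `γ := θ.γ` (the coupling window of record), `E₀ := θ.s2.lf.E₀`, `κ := θ.s2.lf.κ` ((I.1.18)'s, [II] p. 21 ∕ [III] p. 17); every other letter residual (`c`).
[cite: Balaban1988RG2Cluster, p.21 (after (2.41): δ, ½E₀, (I.1.18)); Balaban1988Convergent, p.17 before (2.28) («(iv) it satisfies the inequality (I.1.18)»); Balaban1987RG1, (1.18) p.263] -/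
def c13OfRecord₁₂ (θ : Stage12Params F N) (c : B13.Consts) : B13.Consts :=
  { c with L := θ.ℓ₆ + 1, δ := (1 - 2 / ((θ.ℓ₆ : ℝ) + 1)) / 10, γ := θ.γ, E₀ := θ.s2.lf.E₀, κ := θ.s2.lf.κ }

variable (θ : Stage12Params F N) (c : B13.Consts)

/-- Face: `L` of record. [cite: Balaban1988RG2Cluster, p.9 (L = the block size; bookkeeping)] -/
@[simp] theorem c13OfRecord₁₂_L : (c13OfRecord₁₂ F N θ c).L = θ.ℓ₆ + 1 := rfl

/-- Face: `L` of record is the record's `L`. [cite: Balaban1988RG2Cluster, p.9 (bookkeeping)] -/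
theorem c13OfRecord₁₂_L_eq_L : (c13OfRecord₁₂ F N θ c).L = θ.L := θ.hℓ₆

/-- Face: `δ` of record. [cite: Balaban1988RG2Cluster, p.21 (after (2.41))] -/
@[simp] theorem c13OfRecord₁₂_δ : (c13OfRecord₁₂ F N θ c).δ = (1 - 2 / ((θ.ℓ₆ : ℝ) + 1)) / 10 := rfl

/-- Face: `γ` of record = the coupling window of record. [cite: Balaban1987RG1, Thm 1 p.259 (the interval ]0, γ]; bookkeeping)] -/
@[simp] theorem c13OfRecord₁₂_γ : (c13OfRecord₁₂ F N θ c).γ = θ.γ := rfl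

/-- Face: `E₀` of record = (I.1.18)'s. [cite: Balaban1988RG2Cluster, p.21 («we define ½E₀ as equal to this constant»)] -/
@[simp] theorem c13OfRecord₁₂_E₀ : (c13OfRecord₁₂ F N θ c).E₀ = θ.s2.lf.E₀ := rfl

/-- Face: `κ` of record = (I.1.18)'s decay rate. [cite: Balaban1988RG2Cluster, (2.41) p.21; Balaban1988Convergent, p.17 before (2.28)] -/
@[simp] theorem c13OfRecord₁₂_κ : (c13OfRecord₁₂ F N θ c).κ = θ.s2.lf.κ := rfl

/-- Face: `ε₁` stays residual. [cite: Balaban1988RG2Cluster, (1.36) p.9 (bookkeeping)] -/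
@[simp] theorem c13OfRecord₁₂_ε₁ : (c13OfRecord₁₂ F N θ c).ε₁ = c.ε₁ := rfl

/-- Face: `C₃` stays residual. [cite: Balaban1988RG2Cluster, (1.43) p.11 (bookkeeping)] -/
@[simp] theorem c13OfRecord₁₂_C₃ : (c13OfRecord₁₂ F N θ c).C₃ = c.C₃ := rfl

/-- Re-applying the Stage-3′ convention `L := θ.ℓ₆ + 1` to the letters of record changes nothing. [cite: Balaban1988RG2Cluster, p.9 (bookkeeping)] -/
theorem c13OfRecord₁₂_with_L : ({ c13OfRecord₁₂ F N θ c with L := θ.ℓ₆ + 1 } : B13.Consts) = c13OfRecord₁₂ F N θ c := rfl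

/-- A single-step layer whose letter field IS the letters of record has `c13OfRecord` = the letters of record. [cite: Balaban1988RG2Cluster, p.9 (bookkeeping)] -/
theorem c13OfRecord_eq_c13OfRecord₁₂ (lam : ResidB13 θ.toStage3Params) (h : lam.c = c13OfRecord₁₂ F N θ c) :
    c13OfRecord θ.toStage3Params lam = c13OfRecord₁₂ F N θ c := by
  unfold c13OfRecord; rw [h]; rfl

/-- The record's `L = ℓ₆ + 1` is at least 3 (`L` odd, `1 < L`). [cite: Balaban1987RG1, Thm 1 p.259 (L odd; bookkeeping)] -/
theorem three_le_ell6_succ : 3 ≤ θ.ℓ₆ + 1 := by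
  have h := θ.hL
  rw [← θ.hℓ₆] at h
  obtain ⟨⟨m, hm⟩, h1⟩ := h
  omega

/-- **R22 HOLDS AT THE LETTERS OF RECORD**: «(1 − 10δ)½L = 1» is an identity at `δ := (1 − 2∕L)∕10`, `L = ℓ₆ + 1` — (iv⁵)'s `h22` discharged at the record.
[cite: Balaban1988RG2Cluster, p.21 (after (2.41): «At first we assume that (1 − 10δ)½L = 1, or δ = (1∕10)(1 − 2L⁻¹)»)] -/
theorem c13OfRecord₁₂_R22 : (c13OfRecord₁₂ F N θ c).R22 := by
  have hL : ((θ.ℓ₆ : ℝ) + 1) ≠ 0 := by positivity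
  show (1 - 10 * ((1 - 2 / ((θ.ℓ₆ : ℝ) + 1)) / 10)) * (((θ.ℓ₆ + 1 : ℕ) : ℝ) / 2) = 1
  rw [Nat.cast_add, Nat.cast_one]
  field_simp
  ring

/-- `0 < δ < 1∕10` at the letters of record (`B13.Consts.delta_bounds_of_R22`, `L ≥ 3`). [cite: Balaban1988RG2Cluster, p.21 (after (2.41))] -/
theorem c13OfRecord₁₂_delta_bounds : 0 < (c13OfRecord₁₂ F N θ c).δ ∧ (c13OfRecord₁₂ F N θ c).δ < 1 / 10 := by
  refine B13.Consts.delta_bounds_of_R22 _ ?_ (c13OfRecord₁₂_R22 F N θ c)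
  rw [c13OfRecord₁₂_L]
  exact_mod_cast three_le_ell6_succ F N θ

/-- `δ < 1` at the letters of record (N10's located input `hδ1`). [cite: Balaban1988RG2Cluster, p.21 (after (2.41))] -/
theorem c13OfRecord₁₂_delta_lt_one : (c13OfRecord₁₂ F N θ c).δ < 1 :=
  (c13OfRecord₁₂_delta_bounds F N θ c).2.trans (by norm_num)

/-- **A Stage-12 history-indexed [B13] layer per run.** [cite: Balaban1988RG2Cluster, Lemmas 1–3 pp.9, 11, 20; Balaban1987RG1, Thm 3 p.264] -/
abbrev ResidB13Fam₁₂ (θ : Stage12Params F N) := B12.RunParams → ResidB13Fam θ.toStage3Params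

variable (lamF : ResidB13Fam₁₂ F N θ) (P : B12.RunParams)

/-- **The Stage-12 [B13] step-data family of record at a run** (= (iv⁵)'s `S13`). [cite: Balaban1988RG2Cluster, (1.33)–(1.42) pp.9–11, (2.9) p.14 (objects of record)] -/
def S13FamOfRecord₁₂ : (k : ℕ) → (Fin (k + 1) → ℝ) → B13.StepData := S13FamOfRecord θ.toStage3Params (lamF P)

/-- Face. [cite: Balaban1988RG2Cluster, (1.33) p.9 (bookkeeping)] -/
@[simp] theorem S13FamOfRecord₁₂_apply (k : ℕ) (v : Fin (k + 1) → ℝ) :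
    S13FamOfRecord₁₂ F N θ lamF P k v = (WtOfRecord θ.toStage3Params (lamF P k v)).toStepData := rfl

/-- **THE [B13] FAMILY LEAF OF RECORD AT A STAGE-12 RUN**: the family leaf at the group of record on the box of the coupling window OF RECORD `θ.γ` with the
LETTERS OF RECORD `c13OfRecord₁₂ θ c` — ONE residual `c` for ALL runs (print's constants are uniform in the lattice spacing).
[cite: Balaban1988RG2Cluster, Lemma 1 p.9, Lemma 2 p.11, Lemma 3 p.20; Balaban1987RG1, Thm 3 p.264] -/
def B13FamLeafOfRecord₁₂ : Prop := B13FamLeafOfRecord θ.toStage3Params θ.γ (lamF P) (c13OfRecord₁₂ F N θ c)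

variable {F N θ c lamF P}

/-- The Stage-12 family leaf unfolded. [cite: Balaban1988RG2Cluster, Lemmas 1–3 pp.9, 11, 20 (bookkeeping)] -/
theorem b13FamLeafOfRecord₁₂_iff :
    B13FamLeafOfRecord₁₂ F N θ c lamF P ↔ ∀ k v, v ∈ FlowStep.Box θ.γ k →
      B13.Lemma1Printed (S13FamOfRecord₁₂ F N θ lamF P k v) (c13OfRecord₁₂ F N θ c) ∧
        B13.Lemma2Printed (S13FamOfRecord₁₂ F N θ lamF P k v) (c13OfRecord₁₂ F N θ c) ∧
          B13.Lemma3Printed (S13FamOfRecord₁₂ F N θ lamF P k v) (c13OfRecord₁₂ F N θ c) := Iff.rfl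

/-- **(iv⁵)'s `hfam` binder BY SHAPE** at `S13 := S13FamOfRecord₁₂ θ lamF P`, `c13 := c13OfRecord₁₂ θ c`, `γ13 := θ.γ` (the premiss `b` — the world's `b13` — unused:
the leaf of record is asserted outright). [cite: Balaban1987RG1, Thm 3 p.264; Balaban1988RG2Cluster, Lemmas 1–3 pp.9, 11, 20] -/
theorem hfam_of_b13FamLeafOfRecord₁₂ (h : B13FamLeafOfRecord₁₂ F N θ c lamF P) (b : Prop) :
    b → ∀ k v, v ∈ FlowStep.Box θ.γ k →
      B13.Lemma1Printed (S13FamOfRecord₁₂ F N θ lamF P k v) (c13OfRecord₁₂ F N θ c) ∧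
        B13.Lemma2Printed (S13FamOfRecord₁₂ F N θ lamF P k v) (c13OfRecord₁₂ F N θ c) ∧
          B13.Lemma3Printed (S13FamOfRecord₁₂ F N θ lamF P k v) (c13OfRecord₁₂ F N θ c) := fun _ => h

/-- (iv⁵)'s `h22` at the record: the family's constants satisfy R22. [cite: Balaban1988RG2Cluster, p.21 (after (2.41))] -/
theorem h22_of_record₁₂ : (c13OfRecord₁₂ F N θ c).R22 := c13OfRecord₁₂_R22 F N θ c

/-- (iv⁵)'s guard `hγ13 : γw ≤ γ13` at the record reads `γw ≤ θ.γ`: the leaf of record restricts to every world window `γw ≤ θ.γ`.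
[cite: Balaban1987RG1, Thm 1 p.259 (the interval constant; bookkeeping)] -/
theorem b13FamLeafOfRecord₁₂_of_window (h : B13FamLeafOfRecord₁₂ F N θ c lamF P) {γw : ℝ} (hγw : γw ≤ θ.γ) :
    B13FamLeafOfRecord θ.toStage3Params γw (lamF P) (c13OfRecord₁₂ F N θ c) :=
  b13FamLeafOfRecord_mono hγw h

/-- **The reading at the record's OWN generated couplings**: while the run's couplings of record `gOfRecord₁₀` stay in the window up to step `k`
(`Step.InInterval θ.γ k`), the family leaf of record yields Lemmas 1–3 at the member of the prefix `(g_0, …, g_k)` of record.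
[cite: Balaban1987RG1, Thm 3 p.264 (consumes Lemmas 1–3 along the run); Balaban1989LargeFieldII, (0.1) p.355 (the run of record)] -/
theorem b13FamLeafOfRecord₁₂_at_gOfRecord (h : B13FamLeafOfRecord₁₂ F N θ c lamF P) {k : ℕ}
    (hg : Step.InInterval θ.γ k (gOfRecord₁₀ F N θ.toStage9Params P)) :
    B13.Lemma1Printed (WtOfRecord θ.toStage3Params (lamF P k (prefixOf (gOfRecord₁₀ F N θ.toStage9Params P) k))).toStepData (c13OfRecord₁₂ F N θ c) ∧
      B13.Lemma2Printed (WtOfRecord θ.toStage3Params (lamF P k (prefixOf (gOfRecord₁₀ F N θ.toStage9Params P) k))).toStepData (c13OfRecord₁₂ F N θ c) ∧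
        B13.Lemma3Printed (WtOfRecord θ.toStage3Params (lamF P k (prefixOf (gOfRecord₁₀ F N θ.toStage9Params P) k))).toStepData (c13OfRecord₁₂ F N θ c) :=
  b13FamLeafOfRecord_at_prefix le_rfl h hg

/-- **MEMBER BRIDGE at Stage 12**: a member whose letter field is the letters of record has instance leaf = the family's triple; so from the family leaf of record,
g0's `B13LeafOfRecord` holds at every such member in the box — the hypothesis `hleaf` of `N10AtRecord12B13.b13_main_at_view₁₂B13_of_leafOfRecord` ∕ g2's
`b13_main_of_isRecordOfRecord₁₂CB10YZWB8B12B13_of_slots` at the instance pin `lam13 P := lamF P k v`. [cite: Balaban1988RG2Cluster, Lemmas 1–3 pp.9, 11, 20 (bookkeeping)] -/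
theorem b13LeafOfRecord_member₁₂ (h : B13FamLeafOfRecord₁₂ F N θ c lamF P) {k : ℕ} {v : Fin (k + 1) → ℝ} (hv : v ∈ FlowStep.Box θ.γ k)
    (hc : (lamF P k v).c = c13OfRecord₁₂ F N θ c) : B13LeafOfRecord θ.toStage3Params (lamF P k v) :=
  b13LeafOfRecord_of_b13FamLeafOfRecord h hv (c13OfRecord_eq_c13OfRecord₁₂ F N θ c _ hc)

/-- Conversely, member-wise instance leaves (letters of record) give the family leaf of record — the form in which N10's located ∕ termwise junctions
(`N10AtRecord11B13.b13LeafOfRecord_of_located(_termwise)`, member-wise) feed N09's (iv⁵). [cite: Balaban1988RG2Cluster, Lemmas 1–3 pp.9, 11, 20 (bookkeeping)] -/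
theorem b13FamLeafOfRecord₁₂_of_forall_member (hc : ∀ k v, v ∈ FlowStep.Box θ.γ k → (lamF P k v).c = c13OfRecord₁₂ F N θ c)
    (h : ∀ k v, v ∈ FlowStep.Box θ.γ k → B13LeafOfRecord θ.toStage3Params (lamF P k v)) : B13FamLeafOfRecord₁₂ F N θ c lamF P :=
  b13FamLeafOfRecord_of_forall_b13LeafOfRecord (fun k v hv => c13OfRecord_eq_c13OfRecord₁₂ F N θ c _ (hc k v hv)) h

end Letters12

/-! ## §3. Honesty in the family currency: the constant ZERO family passes, a `GaugeInv := False` family fails — lever (i) (THE TERMS) persists member-wise -/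

section HonestyFam

variable (θ : Stage3Params)

/-- **HONESTY (Stage 3′)**: for any final constants `c` (with the Stage-3′ convention `L := θ.ℓ₆ + 1` already applied or not — only the three printed prefactors'
signs matter) the CONSTANT family at g2's ZERO term tower with FULL spaces satisfies the family leaf on EVERY box: sums of no terms are the zero function and every
printed bound reads `0 ≤ prefactor · exp(…)`.  So in the ∃-currency over `lamF` the family leaf is junk through lever (i) = THE TERMS; content = the term tower OF
RECORD (the identification of each member's terms with the record's step-`k` expansion at history `v`; XL, absent) or the ∀-lawful ∕ termwise currency.
[cite: Balaban1988RG2Cluster, (1.33) p.9, (1.41)–(1.42) p.11, (2.9)–(2.14) pp.14–15 (the terms are the expansion's, in print)] -/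
theorem exists_residB13Fam_b13FamLeafOfRecord_of_nonneg (c : B13.Consts) (h136 : 0 ≤ c.E₀ * c.ε₁ * c.C₁ * c.M ^ c.q) (h143 : 0 ≤ c.C₃ * c.ε₁ * c.M ^ 4)
    (h238 : 0 ≤ ({ c with L := θ.ℓ₆ + 1 } : B13.Consts).C3act * c.ε₁) (γ₀ : ℝ) :
    ∃ lamF : ResidB13Fam θ, (∀ k v, (lamF k v).c = c ∧ (∀ Y, (lamF k v).sp1 Y = Set.univ) ∧ (∀ Z, (lamF k v).sp2 Z = Set.univ)) ∧
      B13FamLeafOfRecord θ γ₀ lamF { c with L := θ.ℓ₆ + 1 } := by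
  obtain ⟨lam, hc, h1, h2, -, hleaf⟩ := exists_residB13_b13LeafOfRecord_univ_of_nonneg θ c h136 h143 h238
  refine ⟨fun _ _ => lam, fun _ _ => ⟨hc, h1, h2⟩, fun k v _ => ?_⟩
  have hc' : c13OfRecord θ lam = { c with L := θ.ℓ₆ + 1 } := by unfold c13OfRecord; rw [hc]
  exact (b13LeafOfRecord_iff_of_c13OfRecord_eq (lamF := fun _ _ => lam) (k := k) (v := v) hc').2 hleaf

/-- **DIS-honesty witness (Stage 3′)**: on a non-empty box (`0 < γ₀`) some family FAILS the family leaf (a member with `GaugeInv := False`, g0's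
`exists_residB13_not_b13LeafOfRecord`) — the leaf is not vacuous. [cite: Balaban1988RG2Cluster, Lemma 2 p.11 (the invariance clause)] -/
theorem exists_residB13Fam_not_b13FamLeafOfRecord {γ₀ : ℝ} (hγ₀ : 0 < γ₀) :
    ∃ (lamF : ResidB13Fam θ) (c : B13.Consts), ¬ B13FamLeafOfRecord θ γ₀ lamF { c with L := θ.ℓ₆ + 1 } := by
  obtain ⟨lam, hlam⟩ := exists_residB13_not_b13LeafOfRecord θ
  refine ⟨fun _ _ => lam, lam.c, fun h => hlam ?_⟩
  have hv : (fun _ => γ₀ : Fin (0 + 1) → ℝ) ∈ FlowStep.Box γ₀ 0 := FlowStep.mem_box.2 fun _ => ⟨hγ₀, le_rfl⟩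
  exact (b13LeafOfRecord_iff_of_c13OfRecord_eq (lamF := fun _ _ => lam) (c := { lam.c with L := θ.ℓ₆ + 1 }) (k := 0) (v := fun _ => γ₀) rfl).1
    (h 0 _ hv)

variable (F : T4Family) (N : ℕ) [NeZero N]

/-- **HONESTY AT STAGE 12 (LOCATED-N10-ZEROTOWER, family currency)**: at EVERY Stage-12 package `θ` and for every residual letter record `c` with `ε₁ = 0` (so the
three printed prefactors of the letters of record vanish whatever `E₀ = θ.s2.lf.E₀` is), there is a Stage-12 family — constant at the zero term tower with FULL spaces
and the letters of record — whose family leaf of record HOLDS at every run.  Pinning L, δ, γ, E₀, κ to the record and proving R22 does NOT make the N10 family conjunct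
contentful in the ∃-currency; the residual letters (`ε₁`, …) and THE TERMS remain the prover's.
[cite: Balaban1988RG2Cluster, (1.36) p.9, (1.43) p.11, (2.38) p.20 (the prefactors carry ε₁), (1.33) ∕ (1.41) ∕ (2.9) (the terms are the expansion's)] -/
theorem exists_residB13Fam₁₂_forall_b13FamLeafOfRecord₁₂ (θ : Stage12Params F N) (c : B13.Consts) (hε₁ : c.ε₁ = 0) :
    ∃ lamF : ResidB13Fam₁₂ F N θ, (∀ P k v, (lamF P k v).c = c13OfRecord₁₂ F N θ c ∧ (∀ Y, (lamF P k v).sp1 Y = Set.univ) ∧ (∀ Z, (lamF P k v).sp2 Z = Set.univ)) ∧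
      ∀ P, B13FamLeafOfRecord₁₂ F N θ c lamF P := by
  have h0 : (c13OfRecord₁₂ F N θ c).ε₁ = 0 := hε₁
  obtain ⟨lamF, hF, hleaf⟩ := exists_residB13Fam_b13FamLeafOfRecord_of_nonneg θ.toStage3Params (c13OfRecord₁₂ F N θ c)
    (by rw [h0]; simp) (by rw [h0]; simp) (by rw [h0]; simp) θ.γ
  refine ⟨fun _ => lamF, fun _ k v => hF k v, fun _ => ?_⟩
  show B13FamLeafOfRecord θ.toStage3Params θ.γ lamF (c13OfRecord₁₂ F N θ c)
  rw [← c13OfRecord₁₂_with_L F N θ c]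
  exact hleaf

end HonestyFam

end Literature.MathematicalPhysics.QuantumFieldTheory.Balaban1983to89.Node00

end
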